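/-
Copyright (c) 2026 the pub-hodgecm-mathlib formalisation cell (harness21).  Prover seat hodgecm-mathlib-K2E4-p08 (g0),
Track B «K2-LIT» ∕ h413, line `K2_E4_SingularTransferKappaSign`, dealer pool H1 «SingularPairEigenplane» (K2E4-plan (g0) DEALS
`K2/K2E4-plan/g0/DEALS.K2E4-g0.md`, re-deal 2026-09-03T21:06:32Z).  2026-09-03.
-/
import Literature.NumberTheory.Rogawski1990.KottwitzSignPlaceReadings   -- ★ `exists_diagonal_frame`, `kottwitzSign_eq_of_frame`, `kottwitzSignLocal_toAdelic_eq_neg_one_iff_not_isIsotropic`, …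
import Literature.NumberTheory.Rogawski1990.SingularFramePairRigid       -- ★ `charpoly_eq_of_frame`, `eq_and_eq_of_X_sub_C_sq_mul_eq`
import HarnessLib

/-!
# K2_E4 road (h413 = stmt-HodgeConjecture-24833), pool H1: the EIGENPLANE of the semiregular pair — the frame PINNED to
# `(plane, line) = (e₁, e₂)`, its base change, and the reading of the sockets' «`W₂(γ₀) ⊗ L⁺_v` anisotropic» as the Kottwitz sign `e_v = −1`

Cell `pub/hodgecm-mathlib` (D-0151), Track B (21-frontier RULING «PUSH BOTH» 2026-09-03, director req624, chair K2-lead ORDER #1 §4.4 ∕ #2,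
naming rule s1813), line `Summits/HodgeConjecture/HodgeConjecture/Cruxes/H413/Lines/K2_E4_SingularTransferKappaSign.lean`; helper file
(`--supports stmt-HodgeConjecture-24833`, no socket closed) for the sockets that read the `e₁`-EIGENPLANE `W₂(γ₀) = ker(γ₀ − e₁)` of a
rational SEMIREGULAR `γ₀ ∈ U(H′)(L⁺)` — `(γ₀ − e₁)(γ₀ − e₂) = 0`, `e₁ ≠ e₂`, `charpoly γ₀ = (X − e₁)²(X − e₂)`: #8 `sig_K2E4KottwitzSignOfSheets`
(«`cv·Δ‴_v = −r` iff `W₂(γ₀) ⊗ L⁺_v` is anisotropic»), #18 `sig_K2E4KottwitzSignParity`, #2 ∕ #4, pool H5; sequel `K2E4SingularPairEigenplaneSubmodules`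
(the submodule picture `L³ = W₂ ⊕ W₁`, `dim W₂ = 2`, `W₂ ⊥ W₁`).

THE MATHEMATICS [Rogawski1990, §3.8 Prop. 3.8.1 (a) p. 30: «`G_γ ≅ H′_ξ × E¹`»; §4.1 (4.1.2) pp. 39–40 and §8.2 p. 117: `e(γ₀) = 1`,
`e(γ₀′) = −1` according as the centraliser `U(W₂) × U(1)` is quasi-split or not, i.e. as the hermitian PLANE `W₂` is isotropic or not].
The tree's frame ★ `exists_diagonal_frame` (`γ P = P·diag(a, a, b)`, `ᵗ(σP) H P = diag(d)`, `{a, b} = {α, β}`) leaves the plane∕line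
AMBIGUITY `(a, b) ∈ {(e₁, e₂), (e₂, e₁)}`; the sockets carry `charpoly γ₀ = (X − e₁)²(X − e₂)`, which PINS the plane to `e₁`
(★ `charpoly_eq_of_frame`, ★ `eq_and_eq_of_X_sub_C_sq_mul_eq`).  In the pinned frame, over ANY commutative ring `R` receiving `ι : L → R`
with an involution `τ`, `τ ∘ ι = ι ∘ c` (`L ⊗ L⁺_v` with `c ⊗ 1`; `ℂ` with `conj`), `ker(γ₀ ⊗ 1 − e₁) = (P ⊗ 1)·{(u₀, u₁, 0)}` and
`⟨P z, P z⟩_H = Σ dᵢ τ(zᵢ) zᵢ`, whence «`∀ x, (γ₀ ⊗ 1 − e₁) x = 0 → ⟨x, x⟩_{H′ ⊗ 1} = 0 → x = 0`» ⟺ «`∀ u, d₀ τ(u₀)u₀ + d₁ τ(u₁)u₁ = 0 → u = 0`»,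
the right-hand side of ★ `kottwitzSign_diagonal_eq_neg_one_iff`, read by ★ `KottwitzSignPlaceReadings` as `kottwitzSignLocal … ⟦(γ₀)_v⟧ = −1`
at every finite place (at a split `v` both sides fail) and as `kottwitzSignAt … W (γ₀ ⊗ 1) = −1` at a complex place `W`.

* §1 (any commutative ring): `sub_smul_one_mulVec`, `sum_sum_mul_eq_hermForm` (the sockets' double-sum spelling of `⟨x, x⟩`),
  `mulVec_eq_zero_iff_of_units`, `mulVec_sub_smul_one_eq_zero_iff_of_frame`, `diagonal_sub_smul_one_mulVec_eq_zero_iff`,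
  `hermForm_diagonal_of_apply_two_eq_zero`; **`aniso_eigenplane_iff_binary_of_frame`** (the displayed equivalence for a framed `X`) and its
  base change **`aniso_eigenplane_map_iff_binary_of_frame`**.
* §2 (field, involution, `1 + 1 ≠ 0`, `det H ≠ 0`): `ne_smul_one_of_charpoly_eq`; **`exists_pinned_diagonal_frame`** (`γ P = P·diag(e₁, e₁, e₂)`,
  `ᵗ(σP) H P = diag(d)`, `σ(e₁)e₁ = σ(e₂)e₂ = 1`, `σ dᵢ = dᵢ ≠ 0`); **`aniso_eigenplane_iff_kottwitzSign_eq_neg_one`**.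
* §3 (CM field `L`, `γ₀ : (cmDatum L 3 H′).Rational`, the sockets' binders `hsplit`, `hχ` verbatim, `hherm`, `hanis`; `det_ne_zero_of_anisotropic_herm`):
  **`aniso_local_iff_kottwitzSignLocal_eq_neg_one`** — at EVERY finite place `v` of `L⁺`, the sockets' predicate
  «`∀ x : Fin 3 → L ⊗ L⁺_v, (γ₀ ⊗ 1 − e₁) x = 0 → Σᵢⱼ (c ⊗ 1)(xᵢ) H′ᵢⱼ xⱼ = 0 → x = 0`» ↔ `kottwitzSignLocal L 3 H′ v ⟦(γ₀)_v⟧ = −1`;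
  **`aniso_arch_iff_kottwitzSignAt_eq_neg_one`** — the same over `ℂ` through `W.1.embedding` ↔ `kottwitzSignAt L 3 H′ W (cmRationalToArch L 3 H′ γ₀) = −1`.

WHAT IS NOT HERE.  Hilbert reciprocity ∕ the parity count (#18, ★ `KottwitzSignProductFormula`), the norm criterion for binary planes (pool H5),
and every analytic statement (the (κ-loc) identity #3 and the SIGNED germ constant behind #8 are K2E3's inputs).
HONEST LABEL: HC_CM is proved only modulo the 7 printed citations (2 remaining named inputs: hLiu418 = stmt-HodgeConjecture-24832, h413 =
stmt-HodgeConjecture-24833) until rung 0 closes; this `--supports` helper retires nothing by itself.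

## References
* [Rogawski1990] J. D. Rogawski, *Automorphic Representations of Unitary Groups in Three Variables*, Ann. of Math. Stud. 123 (1990), §3.8
  Prop. 3.8.1 (a) p. 30; §4.1 (4.1.2) pp. 39–40; §8.2 Prop. 8.2.1 p. 117.
* [Kottwitz1983] R. E. Kottwitz, *Sign changes in harmonic analysis on reductive groups*, Trans. Amer. Math. Soc. 278 (1983), 289–297, §1.
-/

set_option autoImplicit false

set_option linter.dupNamespace false

noncomputable section

open Matrix Polynomial Module NumberField IsDedekindDomain
open Literature.NumberTheory.Rogawski1990 Literature.NumberTheory.Automorphic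
open Literature.AlgebraicGeometry.ShimuraVarieties (unitaryGroup mem_unitaryGroup_iff hermForm)
open Literature.NumberTheory.Automorphic.UnitaryGroup (finSum)
open scoped MatrixGroups

namespace Summit.HodgeConjecture.HodgeConjecture.Cruxes.H413.K2E4SingularPairEigenplane

/-! ## §1 Ring-generic bookkeeping and the framed equivalence -/

section Generic

variable {R : Type*} [CommRing R]

/-- `(M − e·1) x = M x − e x`. [cite: Rogawski1990, §3.8 p. 30] -/
theorem sub_smul_one_mulVec (M : Matrix (Fin 3) (Fin 3) R) (e : R) (x : Fin 3 → R) :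
    (M - e • (1 : Matrix (Fin 3) (Fin 3) R)) *ᵥ x = M *ᵥ x - e • x := by
  rw [Matrix.sub_mulVec, Matrix.smul_mulVec, Matrix.one_mulVec]

/-- The sockets' double-sum spelling of the hermitian norm: `Σᵢ Σⱼ τ(xᵢ) Hᵢⱼ xⱼ = ⟨x, x⟩_H` (★ `hermForm`, conjugate-linear in the
first variable). [cite: Rogawski1990, §1.9 p. 11] -/
theorem sum_sum_mul_eq_hermForm (τ : R →+* R) (H : Matrix (Fin 3) (Fin 3) R) (x : Fin 3 → R) :
    (∑ i, ∑ j, τ (x i) * H i j * x j) = hermForm τ H x x := by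
  simp only [hermForm, dotProduct, Matrix.mulVec, Function.comp_apply, Finset.mul_sum, mul_assoc]

/-- An invertible matrix kills no non-zero vector: `P x = 0 ↔ x = 0`. [cite: Rogawski1990, §3.8 p. 30] -/
theorem mulVec_eq_zero_iff_of_units (P : GL (Fin 3) R) (x : Fin 3 → R) :
    (P : Matrix (Fin 3) (Fin 3) R) *ᵥ x = 0 ↔ x = 0 := by
  refine ⟨fun h => ?_, fun h => by rw [h, Matrix.mulVec_zero]⟩
  have h1 : ((P⁻¹ : GL (Fin 3) R) : Matrix (Fin 3) (Fin 3) R) *ᵥ ((P : Matrix (Fin 3) (Fin 3) R) *ᵥ x) = x := by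
    rw [Matrix.mulVec_mulVec, ← Units.val_mul, inv_mul_cancel, Units.val_one, Matrix.one_mulVec]
  rw [← h1, h, Matrix.mulVec_zero]

/-- **Kernel transport through a frame**: if `X P = P D` with `P` invertible then `(X − a) x = 0 ↔ (D − a)(P⁻¹ x) = 0`.
[cite: Rogawski1990, §3.8 Prop. 3.8.1 p. 30] -/
theorem mulVec_sub_smul_one_eq_zero_iff_of_frame {X D : Matrix (Fin 3) (Fin 3) R} (P : GL (Fin 3) R)
    (hXP : X * (P : Matrix (Fin 3) (Fin 3) R) = (P : Matrix (Fin 3) (Fin 3) R) * D) (a : R) (x : Fin 3 → R) :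
    (X - a • (1 : Matrix (Fin 3) (Fin 3) R)) *ᵥ x = 0 ↔
      (D - a • (1 : Matrix (Fin 3) (Fin 3) R)) *ᵥ (((P⁻¹ : GL (Fin 3) R) : Matrix (Fin 3) (Fin 3) R) *ᵥ x) = 0 := by
  have hmat : (X - a • (1 : Matrix (Fin 3) (Fin 3) R)) * (P : Matrix (Fin 3) (Fin 3) R) =
      (P : Matrix (Fin 3) (Fin 3) R) * (D - a • (1 : Matrix (Fin 3) (Fin 3) R)) := by
    rw [Matrix.sub_mul, Matrix.mul_sub, hXP, Matrix.smul_mul, Matrix.mul_smul, Matrix.one_mul, Matrix.mul_one]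
  have hkey : (X - a • (1 : Matrix (Fin 3) (Fin 3) R)) *ᵥ x =
      (P : Matrix (Fin 3) (Fin 3) R) *ᵥ ((D - a • (1 : Matrix (Fin 3) (Fin 3) R)) *ᵥ (((P⁻¹ : GL (Fin 3) R) : Matrix (Fin 3) (Fin 3) R) *ᵥ x)) := by
    rw [Matrix.mulVec_mulVec, Matrix.mulVec_mulVec, ← hmat, Matrix.mul_assoc, ← Units.val_mul, mul_inv_cancel, Units.val_one, Matrix.mul_one]
  rw [hkey, mulVec_eq_zero_iff_of_units]

/-- **The kernel of `diag(a, a, b) − a` is `{z | z₂ = 0}`** when `b − a` is a unit. [cite: Rogawski1990, §3.8 Prop. 3.8.1 p. 30] -/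
theorem diagonal_sub_smul_one_mulVec_eq_zero_iff {a b : R} (hba : IsUnit (b - a)) (z : Fin 3 → R) :
    (Matrix.diagonal ![a, a, b] - a • (1 : Matrix (Fin 3) (Fin 3) R)) *ᵥ z = 0 ↔ z 2 = 0 := by
  have hD : Matrix.diagonal ![a, a, b] - a • (1 : Matrix (Fin 3) (Fin 3) R) = Matrix.diagonal ![0, 0, b - a] := by
    rw [smul_one_eq_diagonal, Matrix.diagonal_sub]
    congr 1
    funext i
    fin_cases i <;> simp
  rw [hD]
  constructor
  · intro h
    have h2 := congrFun h 2
    rw [Matrix.mulVec_diagonal, Pi.zero_apply] at h2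
    simpa using (hba.mul_right_eq_zero).1 h2
  · intro h
    funext i
    rw [Matrix.mulVec_diagonal, Pi.zero_apply]
    fin_cases i <;> simp [h]

/-- The norm of a vector with vanishing last coordinate in a DIAGONAL Gram matrix: `⟨z, z⟩_{diag t} = t₀ τ(z₀)z₀ + t₁ τ(z₁)z₁`.
[cite: Rogawski1990, §1.9 p. 11] -/
theorem hermForm_diagonal_of_apply_two_eq_zero (τ : R →+* R) (t : Fin 3 → R) {z : Fin 3 → R} (hz : z 2 = 0) :
    hermForm τ (Matrix.diagonal t) z z = t 0 * (τ (z 0) * z 0) + t 1 * (τ (z 1) * z 1) := by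
  simp only [hermForm, dotProduct, Matrix.mulVec_diagonal, Function.comp_apply, Fin.sum_univ_three, hz, map_zero,
    mul_zero, add_zero]
  ring

/-- **THE FRAMED EQUIVALENCE** (any commutative ring `R`, any `τ : R →+* R`): if `X P = P·diag(a, a, b)` with `P` invertible, `b − a` a unit
and `ᵗ(τP) H P = diag(t)`, then «every `H`-isotropic vector of `ker(X − a)` vanishes» iff «the binary form `⟨t₀, t₁⟩` is anisotropic»
(the right-hand side of ★ `kottwitzSign_diagonal_eq_neg_one_iff`). [cite: Rogawski1990, §3.8 Prop. 3.8.1 (a) p. 30; §8.2 p. 117] -/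
theorem aniso_eigenplane_iff_binary_of_frame (τ : R →+* R) (H : Matrix (Fin 3) (Fin 3) R) {X : Matrix (Fin 3) (Fin 3) R}
    (P : GL (Fin 3) R) {a b : R} (hba : IsUnit (b - a))
    (hXP : X * (P : Matrix (Fin 3) (Fin 3) R) = (P : Matrix (Fin 3) (Fin 3) R) * Matrix.diagonal ![a, a, b])
    (t : Fin 3 → R) (hHP : ((P : Matrix (Fin 3) (Fin 3) R).map τ)ᵀ * H * (P : Matrix (Fin 3) (Fin 3) R) = Matrix.diagonal t) :
    (∀ x : Fin 3 → R, (X - a • (1 : Matrix (Fin 3) (Fin 3) R)) *ᵥ x = 0 → hermForm τ H x x = 0 → x = 0) ↔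
      ∀ u : Fin 2 → R, t 0 * (τ (u 0) * u 0) + t 1 * (τ (u 1) * u 1) = 0 → u = 0 := by
  constructor
  · intro h u hu
    -- the vector `P (u₀, u₁, 0)` is an `H`-isotropic vector of `ker (X − a)`
    set z : Fin 3 → R := ![u 0, u 1, 0] with hz
    have hz2 : z 2 = 0 := by simp [hz]
    have hPinv : ((P⁻¹ : GL (Fin 3) R) : Matrix (Fin 3) (Fin 3) R) *ᵥ ((P : Matrix (Fin 3) (Fin 3) R) *ᵥ z) = z := by
      rw [Matrix.mulVec_mulVec, ← Units.val_mul, inv_mul_cancel, Units.val_one, Matrix.one_mulVec]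
    have hker : (X - a • (1 : Matrix (Fin 3) (Fin 3) R)) *ᵥ ((P : Matrix (Fin 3) (Fin 3) R) *ᵥ z) = 0 := by
      rw [mulVec_sub_smul_one_eq_zero_iff_of_frame P hXP, hPinv, diagonal_sub_smul_one_mulVec_eq_zero_iff hba]
      exact hz2
    have hiso : hermForm τ H ((P : Matrix (Fin 3) (Fin 3) R) *ᵥ z) ((P : Matrix (Fin 3) (Fin 3) R) *ᵥ z) = 0 := by
      rw [← hermForm_congr, hHP, hermForm_diagonal_of_apply_two_eq_zero τ t hz2]
      simpa [hz] using hu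
    have hPz : (P : Matrix (Fin 3) (Fin 3) R) *ᵥ z = 0 := h _ hker hiso
    have hz0 : z = 0 := (mulVec_eq_zero_iff_of_units P z).1 hPz
    funext i
    fin_cases i <;> [simpa [hz] using congrFun hz0 0; simpa [hz] using congrFun hz0 1]
  · intro h x hx hiso
    -- `x = P z` with `z₂ = 0`; its norm is the binary form at `(z₀, z₁)`
    set z : Fin 3 → R := ((P⁻¹ : GL (Fin 3) R) : Matrix (Fin 3) (Fin 3) R) *ᵥ x with hz
    have hxz : x = (P : Matrix (Fin 3) (Fin 3) R) *ᵥ z := by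
      rw [hz, Matrix.mulVec_mulVec, ← Units.val_mul, mul_inv_cancel, Units.val_one, Matrix.one_mulVec]
    have hz2 : z 2 = 0 := by
      rw [mulVec_sub_smul_one_eq_zero_iff_of_frame P hXP, diagonal_sub_smul_one_mulVec_eq_zero_iff hba] at hx
      exact hx
    have hform : t 0 * (τ (z 0) * z 0) + t 1 * (τ (z 1) * z 1) = 0 := by
      rw [hxz, ← hermForm_congr, hHP, hermForm_diagonal_of_apply_two_eq_zero τ t hz2] at hiso
      exact hiso
    have hu : ![z 0, z 1] = 0 := h ![z 0, z 1] (by simpa using hform)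
    have hzz : z = 0 := by
      funext i
      fin_cases i <;> [simpa using congrFun hu 0; simpa using congrFun hu 1; exact hz2]
    rw [hxz, hzz, Matrix.mulVec_zero]


/-- **The framed equivalence AFTER BASE CHANGE** along `ι : K →+* R` intertwining the involutions (`τ ∘ ι = ι ∘ σ`): for a frame over `K`
(`X P = P·diag(e₁, e₁, e₂)`, `ᵗ(σP) H P = diag(d)`, `e₁ − e₂` a unit), «every `H ⊗ 1`-isotropic vector of `ker(X ⊗ 1 − ι e₁)` vanishes» iff
«`∀ u : Fin 2 → R, ι d₀·τ(u₀)u₀ + ι d₁·τ(u₁)u₁ = 0 → u = 0`» (the frame is mapped by ★ `Matrix.GeneralLinearGroup.map ι`).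
[cite: Rogawski1990, §3.8 Prop. 3.8.1 (a) p. 30; §8.2 p. 117] -/
theorem aniso_eigenplane_map_iff_binary_of_frame {K : Type*} [CommRing K] (σ : K →+* K) (τ : R →+* R) (ι : K →+* R)
    (hι : ∀ x, τ (ι x) = ι (σ x)) {X H : Matrix (Fin 3) (Fin 3) K} (P : GL (Fin 3) K) {e₁ e₂ : K} (hne : IsUnit (e₂ - e₁))
    (hXP : X * (P : Matrix (Fin 3) (Fin 3) K) = (P : Matrix (Fin 3) (Fin 3) K) * Matrix.diagonal ![e₁, e₁, e₂])
    {d : Fin 3 → K} (hHP : ((P : Matrix (Fin 3) (Fin 3) K).map σ)ᵀ * H * (P : Matrix (Fin 3) (Fin 3) K) = Matrix.diagonal d) :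
    (∀ x : Fin 3 → R, (X.map ι - ι e₁ • (1 : Matrix (Fin 3) (Fin 3) R)) *ᵥ x = 0 → hermForm τ (H.map ι) x x = 0 → x = 0) ↔
      ∀ u : Fin 2 → R, ι (d 0) * (τ (u 0) * u 0) + ι (d 1) * (τ (u 1) * u 1) = 0 → u = 0 := by
  set Pv : GL (Fin 3) R := Matrix.GeneralLinearGroup.map ι P with hPv
  have hPvval : (Pv.val : Matrix (Fin 3) (Fin 3) R) = (P : Matrix (Fin 3) (Fin 3) K).map ι := rfl
  have hframe : X.map ι * (Pv.val : Matrix (Fin 3) (Fin 3) R) = (Pv.val : Matrix (Fin 3) (Fin 3) R) * Matrix.diagonal ![ι e₁, ι e₁, ι e₂] := by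
    rw [hPvval, ← Matrix.map_mul, hXP, Matrix.map_mul, Matrix.diagonal_map (map_zero ι)]
    congr 2
    funext i; fin_cases i <;> rfl
  have hcongr : ((Pv.val : Matrix (Fin 3) (Fin 3) R).map τ)ᵀ * H.map ι * (Pv.val : Matrix (Fin 3) (Fin 3) R) = Matrix.diagonal (fun i => ι (d i)) := by
    have hmapσ : ((P : Matrix (Fin 3) (Fin 3) K).map ι).map τ = (((P : Matrix (Fin 3) (Fin 3) K)).map σ).map ι := by
      rw [Matrix.map_map, Matrix.map_map]
      exact congrArg _ (funext fun x => hι x)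
    rw [hPvval, hmapσ, ← Matrix.transpose_map, ← Matrix.map_mul, ← Matrix.map_mul, hHP, Matrix.diagonal_map (map_zero ι)]
  have hba : IsUnit (ι e₂ - ι e₁) := by rw [← map_sub]; exact hne.map ι
  exact aniso_eigenplane_iff_binary_of_frame τ (H.map ι) Pv hba hframe (fun i => ι (d i)) hcongr

end Generic

/-! ## §2 Over a field: the frame PINNED to `(e₁, e₂)` by the characteristic polynomial, and the Kottwitz-sign reading -/

section Field

variable {K : Type*} [Field K] (σ : K →+* K)

omit σ in
/-- A matrix with `charpoly = (X − e₁)²(X − e₂)`, `e₁ ≠ e₂`, is NOT a scalar: `(X − e)³ = (X − e₁)²(X − e₂)` evaluated at `e₁` and at `e₂` would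
give `e = e₁ = e₂` (★ `charpoly_smul_one_eq_pow`). [cite: Rogawski1990, §3.8 Prop. 3.8.1 p. 30] -/
theorem ne_smul_one_of_charpoly_eq {M : Matrix (Fin 3) (Fin 3) K} {e₁ e₂ : K} (hne : e₁ ≠ e₂)
    (hχ : M.charpoly = (X - C e₁) ^ 2 * (X - C e₂)) (e : K) : M ≠ e • (1 : Matrix (Fin 3) (Fin 3) K) := by
  intro h
  have hc : (X - C e) ^ 3 = (X - C e₁) ^ 2 * (X - C e₂) := by rw [← hχ, h, charpoly_smul_one_eq_pow]
  have key : ∀ x : K, (x - e) ^ 3 = (x - e₁) ^ 2 * (x - e₂) := fun x => by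
    simpa only [eval_pow, eval_mul, eval_sub, eval_X, eval_C] using congrArg (Polynomial.eval x) hc
  have h1 := key e₁
  have h2 := key e₂
  rw [sub_self, zero_pow two_ne_zero, zero_mul] at h1
  rw [sub_self, mul_zero] at h2
  exact hne ((sub_eq_zero.1 (eq_zero_of_pow_eq_zero h1)).trans (sub_eq_zero.1 (eq_zero_of_pow_eq_zero h2)).symm)

/-- **THE PINNED DIAGONAL FRAME of a semiregular element** (`K` a field with an involution `σ`, `1 + 1 ≠ 0`, `H ∈ M₃(K)` hermitian with `det H ≠ 0`,
`γ ∈ U_σ(H)(K)` with `(γ − e₁)(γ − e₂) = 0`, `e₁ ≠ e₂` and `charpoly γ = (X − e₁)²(X − e₂)`): `σ(e₁)e₁ = σ(e₂)e₂ = 1` and there are `P ∈ GL₃(K)` and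
REAL NON-ZERO `d₀, d₁, d₂` (`σ dᵢ = dᵢ`) with `ᵗ(σP) H P = diag(d)` and `γ P = P·diag(e₁, e₁, e₂)` — the first two columns of `P` span the
`e₁`-EIGENPLANE `W₂(γ)`, the third the `e₂`-eigenline; ★ `exists_diagonal_frame` with the plane∕line ambiguity removed by the characteristic polynomial
(★ `charpoly_eq_of_frame`, ★ `eq_and_eq_of_X_sub_C_sq_mul_eq`). [cite: Rogawski1990, §3.8 Prop. 3.8.1 (a) p. 30] -/
theorem exists_pinned_diagonal_frame (hσ : ∀ x, σ (σ x) = x) (h2 : (1 : K) + 1 ≠ 0) {H : Matrix (Fin 3) (Fin 3) K}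
    (hH : (H.map σ)ᵀ = H) (hdet : H.det ≠ 0) (γ : unitaryGroup σ H) {e₁ e₂ : K} (hne : e₁ ≠ e₂)
    (hsplit : (((γ : GL (Fin 3) K) : Matrix (Fin 3) (Fin 3) K) - e₁ • 1) * (((γ : GL (Fin 3) K) : Matrix (Fin 3) (Fin 3) K) - e₂ • 1) = 0)
    (hχ : (((γ : GL (Fin 3) K) : Matrix (Fin 3) (Fin 3) K)).charpoly = (X - C e₁) ^ 2 * (X - C e₂)) :
    ∃ (P : GL (Fin 3) K) (d : Fin 3 → K),
      σ e₁ * e₁ = 1 ∧ σ e₂ * e₂ = 1 ∧ (∀ i, σ (d i) = d i) ∧ (∀ i, d i ≠ 0) ∧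
      (((P : Matrix (Fin 3) (Fin 3) K)).map σ)ᵀ * H * (P : Matrix (Fin 3) (Fin 3) K) = Matrix.diagonal d ∧
      ((γ : GL (Fin 3) K) : Matrix (Fin 3) (Fin 3) K) * (P : Matrix (Fin 3) (Fin 3) K) =
        (P : Matrix (Fin 3) (Fin 3) K) * Matrix.diagonal ![e₁, e₁, e₂] := by
  obtain ⟨a, b, P, d, hab, ha, hb, hdσ, hd0, hHP, hγP⟩ :=
    exists_diagonal_frame σ hσ h2 H hH hdet γ hne hsplit (ne_smul_one_of_charpoly_eq hne hχ e₁) (ne_smul_one_of_charpoly_eq hne hχ e₂)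
  have hab' : a ≠ b := by
    rcases hab with ⟨rfl, rfl⟩ | ⟨rfl, rfl⟩
    · exact hne
    · exact hne.symm
  have hχ' : (((γ : GL (Fin 3) K) : Matrix (Fin 3) (Fin 3) K)).charpoly = (X - C a) ^ 2 * (X - C b) := by
    have h := charpoly_eq_of_frame (N₁ := 2) (N₂ := 1) hγP
    rw [pow_one] at h
    exact h
  obtain ⟨rfl, rfl⟩ := eq_and_eq_of_X_sub_C_sq_mul_eq hab' hne (hχ'.symm.trans hχ)
  refine ⟨P, d, ha, hb, hdσ, hd0, hHP, ?_⟩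
  rw [hγP, finSum_smul_one_eq_diagonal]


/-- **The eigenplane reading of the Kottwitz sign over a field** (`σ` injective): «every `H`-isotropic vector of `W₂(γ) = ker(γ − e₁)` vanishes»
iff `e_H(γ) = −1` (★ `kottwitzSign`; ★ `kottwitzSign_eq_of_frame` + ★ `kottwitzSign_diagonal_eq_neg_one_iff` in the pinned frame).
[cite: Rogawski1990, §4.1 (4.1.2) pp. 39–40; §8.2 p. 117] [cite: Kottwitz1983, §1] -/
theorem aniso_eigenplane_iff_kottwitzSign_eq_neg_one (hσ : ∀ x, σ (σ x) = x) (h2 : (1 : K) + 1 ≠ 0)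
    {H : Matrix (Fin 3) (Fin 3) K} (hH : (H.map σ)ᵀ = H) (hdet : H.det ≠ 0) (γ : unitaryGroup σ H) {e₁ e₂ : K} (hne : e₁ ≠ e₂)
    (hsplit : (((γ : GL (Fin 3) K) : Matrix (Fin 3) (Fin 3) K) - e₁ • 1) * (((γ : GL (Fin 3) K) : Matrix (Fin 3) (Fin 3) K) - e₂ • 1) = 0)
    (hχ : (((γ : GL (Fin 3) K) : Matrix (Fin 3) (Fin 3) K)).charpoly = (X - C e₁) ^ 2 * (X - C e₂)) :
    (∀ x : Fin 3 → K, (((γ : GL (Fin 3) K) : Matrix (Fin 3) (Fin 3) K) - e₁ • (1 : Matrix (Fin 3) (Fin 3) K)) *ᵥ x = 0 →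
        hermForm σ H x x = 0 → x = 0) ↔
      kottwitzSign σ H ((γ : GL (Fin 3) K) : Matrix (Fin 3) (Fin 3) K) = -1 := by
  obtain ⟨P, d, -, -, -, hd0, hHP, hγP⟩ := exists_pinned_diagonal_frame σ hσ h2 hH hdet γ hne hsplit hχ
  have hσinj : Function.Injective σ := fun x y hxy => by rw [← hσ x, ← hσ y, hxy]
  have hframe : ((γ : GL (Fin 3) K) : Matrix (Fin 3) (Fin 3) K) * (P : Matrix (Fin 3) (Fin 3) K) =
      (P : Matrix (Fin 3) (Fin 3) K) * finSum 2 1 (e₁ • (1 : Matrix (Fin 2) (Fin 2) K)) (e₂ • (1 : Matrix (Fin 1) (Fin 1) K)) := by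
    rw [hγP, finSum_smul_one_eq_diagonal]
  rw [aniso_eigenplane_iff_binary_of_frame σ H P (sub_ne_zero.2 hne.symm).isUnit hγP d hHP,
    kottwitzSign_eq_of_frame σ H P hframe d hHP, kottwitzSign_diagonal_eq_neg_one_iff σ hσinj (sub_ne_zero.2 hne).isUnit d (hd0 2)]

end Field

/-! ## §3 The CM readings: the sockets' «`W₂(γ₀) ⊗ L⁺_v` anisotropic» IS `kottwitzSignLocal … v ⟦(γ₀)_v⟧ = −1` -/

section CM

variable (L : Type) [Field L] [NumberField L] [IsCMField L] (H' : Matrix (Fin 3) (Fin 3) L)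

/-- `H′` anisotropic ⟹ `det H′ ≠ 0` (a kernel vector would be isotropic). [cite: Rogawski1990, §3.8 p. 30] -/
theorem det_ne_zero_of_anisotropic_herm (hanis : ∀ x : Fin 3 → L, hermForm (cmConjRingHom L) H' x x = 0 → x = 0) : H'.det ≠ 0 := by
  intro hdet
  obtain ⟨w, hw, hHw⟩ := Matrix.exists_mulVec_eq_zero_iff.mpr hdet
  refine hw (hanis w ?_)
  rw [hermForm, hHw, dotProduct_zero]

/-- **THE FINITE-PLACE READING** — at EVERY finite place `v` of `L⁺`, for a rational semiregular `γ₀ ∈ U(H′)(L⁺)` with the sockets' binders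
(`(γ₀ − e₁)(γ₀ − e₂) = 0`, `e₁ ≠ e₂`, `charpoly γ₀ = (X − e₁)²(X − e₂)`) and `H′` hermitian anisotropic: the sockets' predicate
«`∀ x : Fin 3 → L ⊗ L⁺_v`, `(γ₀ ⊗ 1 − e₁) x = 0 → Σᵢⱼ (c ⊗ 1)(xᵢ) H′ᵢⱼ xⱼ = 0 → x = 0`» (the `e₁`-eigenplane `W₂(γ₀) ⊗ L⁺_v` is ANISOTROPIC)
holds iff `kottwitzSignLocal L 3 H′ v ⟦(γ₀)_v⟧ = −1` (★ `KottwitzSignCM`): at a non-split `v`, «`e(γ₀′) = −1`» iff the centraliser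
`U(W₂) × U(1)` is not quasi-split [§8.2 p. 117]; at a split `v` both sides fail (★ `kottwitzSignLocal_toAdelic_eq_neg_one_iff_not_isIsotropic`).
[cite: Rogawski1990, §4.1 (4.1.2) pp. 39–40; §8.2 Prop. 8.2.1 p. 117] [cite: Kottwitz1983, §1] -/
theorem aniso_local_iff_kottwitzSignLocal_eq_neg_one
    (hherm : (H'.map (cmConjRingHom L)).transpose = H') (hanis : ∀ x : Fin 3 → L, hermForm (cmConjRingHom L) H' x x = 0 → x = 0)
    (γ₀ : (UnitaryGroup.cmDatum L 3 H').Rational) (e₁ e₂ : L) (hne : e₁ ≠ e₂)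
    (hsplit : ((((γ₀ : unitaryGroup (cmConjRingHom L) H').val : GL (Fin 3) L) : Matrix (Fin 3) (Fin 3) L) - e₁ • (1 : Matrix (Fin 3) (Fin 3) L)) *
      ((((γ₀ : unitaryGroup (cmConjRingHom L) H').val : GL (Fin 3) L) : Matrix (Fin 3) (Fin 3) L) - e₂ • (1 : Matrix (Fin 3) (Fin 3) L)) = 0)
    (hχ : (((γ₀ : unitaryGroup (cmConjRingHom L) H').val : GL (Fin 3) L) : Matrix (Fin 3) (Fin 3) L).charpoly =
      (Polynomial.X - Polynomial.C e₁) ^ 2 * (Polynomial.X - Polynomial.C e₂))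
    (v : HeightOneSpectrum (𝓞 ↥(maximalRealSubfield L))) :
    (∀ x : Fin 3 → UnitaryGroup.LocalRing L v,
        Matrix.mulVec (((((γ₀ : unitaryGroup (cmConjRingHom L) H').val : GL (Fin 3) L) : Matrix (Fin 3) (Fin 3) L)).map
              (algebraMap L (UnitaryGroup.LocalRing L v)) -
            algebraMap L (UnitaryGroup.LocalRing L v) e₁ • (1 : Matrix (Fin 3) (Fin 3) (UnitaryGroup.LocalRing L v))) x = 0 →
        (∑ i, ∑ j, UnitaryGroup.conjLocal L (IsCMField.complexConj L) v (x i) * algebraMap L (UnitaryGroup.LocalRing L v) (H' i j) * x j) = 0 →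
        x = 0) ↔
      kottwitzSignLocal L 3 H' v (ConjClasses.mk ((UnitaryGroup.cmDatum L 3 H').toLocal v ((UnitaryGroup.cmDatum L 3 H').toAdelic γ₀))) = -1 := by
  classical
  set ι := algebraMap L (UnitaryGroup.LocalRing L v) with hι
  set σv := UnitaryGroup.conjLocal L (IsCMField.complexConj L) v with hσv
  -- the pinned diagonal frame over `L`
  obtain ⟨P, d, -, -, hdσ, hd0, hHP, hγP⟩ := exists_pinned_diagonal_frame (cmConjRingHom L) (IsCMField.complexConj_apply_apply L)
    (by norm_num) hherm (det_ne_zero_of_anisotropic_herm L H' hanis) (γ₀ : unitaryGroup (cmConjRingHom L) H') hne hsplit hχ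
  have hγPfin : ((((γ₀ : unitaryGroup (cmConjRingHom L) H').val : GL (Fin 3) L) : Matrix (Fin 3) (Fin 3) L)) * (P : Matrix (Fin 3) (Fin 3) L) =
      (P : Matrix (Fin 3) (Fin 3) L) * finSum 2 1 (e₁ • (1 : Matrix (Fin 2) (Fin 2) L)) (e₂ • (1 : Matrix (Fin 1) (Fin 1) L)) := by
    rw [hγP, finSum_smul_one_eq_diagonal]
  -- LEFT: the sockets' predicate is the binary anisotropy of `⟨d₀, d₁⟩ ⊗ L⁺_v` (§1, frame mapped to `L ⊗ L⁺_v`)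
  have hσι : ∀ x : L, σv (ι x) = ι (cmConjRingHom L x) := fun x => by
    rw [hσv, hι, cmConjRingHom_apply, UnitaryGroup.conjLocal_algebraMap]
  have hform : ∀ x : Fin 3 → UnitaryGroup.LocalRing L v,
      (∑ i, ∑ j, σv (x i) * ι (H' i j) * x j) = hermForm σv (H'.map ι) x x := fun x =>
    sum_sum_mul_eq_hermForm σv (H'.map ι) x
  have hleft : (∀ x : Fin 3 → UnitaryGroup.LocalRing L v,
        Matrix.mulVec (((((γ₀ : unitaryGroup (cmConjRingHom L) H').val : GL (Fin 3) L) : Matrix (Fin 3) (Fin 3) L)).map ι -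
            ι e₁ • (1 : Matrix (Fin 3) (Fin 3) (UnitaryGroup.LocalRing L v))) x = 0 →
        (∑ i, ∑ j, σv (x i) * ι (H' i j) * x j) = 0 → x = 0) ↔
      ∀ u : Fin 2 → UnitaryGroup.LocalRing L v, ι (d 0) * (σv (u 0) * u 0) + ι (d 1) * (σv (u 1) * u 1) = 0 → u = 0 := by
    rw [← aniso_eigenplane_map_iff_binary_of_frame (cmConjRingHom L) σv ι hσι P (sub_ne_zero.2 hne.symm).isUnit hγP hHP]
    simp only [hform]
  rw [hleft]
  -- RIGHT: ★ `KottwitzSignPlaceReadings` reads the local sign on the same binary form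
  obtain ⟨x, hx⟩ : ∃ x : L, IsCMField.complexConj L x ≠ x := by
    by_contra! h
    exact IsCMField.complexConj_ne_one L (AlgEquiv.ext h)
  set δ : L := x - IsCMField.complexConj L x with hδdef
  have hcδ : IsCMField.complexConj L δ = -δ := by rw [hδdef, map_sub, IsCMField.complexConj_apply_apply, neg_sub]
  have hδ : δ ≠ 0 := fun h0 => hx (sub_eq_zero.1 h0).symm
  have hdc : ∀ i, IsCMField.complexConj L (d i) = d i := fun i => by rw [← cmConjRingHom_apply]; exact hdσ i
  have hJh : ((Matrix.diagonal ![d 0, d 1]).map (IsCMField.complexConj L))ᵀ = Matrix.diagonal ![d 0, d 1] := by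
    rw [Matrix.diagonal_map (map_zero _), Matrix.diagonal_transpose]
    congr 1
    funext i; fin_cases i <;> [exact hdc 0; exact hdc 1]
  have hJdet : (Matrix.diagonal ![d 0, d 1]).det ≠ 0 := by
    rw [Matrix.det_diagonal, Fin.prod_univ_two]; exact mul_ne_zero (hd0 0) (hd0 1)
  rw [kottwitzSignLocal_toAdelic_eq_neg_one_iff_not_isIsotropic v γ₀ (sub_ne_zero.2 hne).isUnit hd0 hHP hγPfin hcδ hδ hJh hJdet,
    isIsotropic_standingData_diagonal_iff]
  simp only [Matrix.cons_val_zero, Matrix.cons_val_one, not_exists, not_and]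
  exact ⟨fun h u hu0 hu => hu0 (h u hu), fun h u hu => by_contra fun hu0 => h u hu0 hu⟩

/-- **THE ARCHIMEDEAN READING** — at a complex place `W` of `L`, with `φ = σ_W : L → ℂ`: the sockets' predicate
«`∀ x : Fin 3 → ℂ`, `(φ(γ₀) − φ(e₁)) x = 0 → Σᵢⱼ conj(xᵢ) φ(H′ᵢⱼ) xⱼ = 0 → x = 0`» (the eigenplane `W₂(γ₀) ⊗_{L,φ} ℂ` is DEFINITE) holds iff
`kottwitzSignAt L 3 H′ W (γ₀ ⊗ 1) = −1` (★ `KottwitzSignCM`; «`e(γ₀′) = −1`» for the compact centraliser, [§8.2 p. 117]).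
[cite: Rogawski1990, §8.2 Prop. 8.2.1 p. 117; §4.1 (4.1.2) p. 39] [cite: Kottwitz1983, §1] -/
theorem aniso_arch_iff_kottwitzSignAt_eq_neg_one
    (hherm : (H'.map (cmConjRingHom L)).transpose = H') (hanis : ∀ x : Fin 3 → L, hermForm (cmConjRingHom L) H' x x = 0 → x = 0)
    (γ₀ : (UnitaryGroup.cmDatum L 3 H').Rational) (e₁ e₂ : L) (hne : e₁ ≠ e₂)
    (hsplit : ((((γ₀ : unitaryGroup (cmConjRingHom L) H').val : GL (Fin 3) L) : Matrix (Fin 3) (Fin 3) L) - e₁ • (1 : Matrix (Fin 3) (Fin 3) L)) *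
      ((((γ₀ : unitaryGroup (cmConjRingHom L) H').val : GL (Fin 3) L) : Matrix (Fin 3) (Fin 3) L) - e₂ • (1 : Matrix (Fin 3) (Fin 3) L)) = 0)
    (hχ : (((γ₀ : unitaryGroup (cmConjRingHom L) H').val : GL (Fin 3) L) : Matrix (Fin 3) (Fin 3) L).charpoly =
      (Polynomial.X - Polynomial.C e₁) ^ 2 * (Polynomial.X - Polynomial.C e₂))
    (W : {w : InfinitePlace L // InfinitePlace.IsComplex w}) :
    (∀ x : Fin 3 → ℂ,
        Matrix.mulVec (((((γ₀ : unitaryGroup (cmConjRingHom L) H').val : GL (Fin 3) L) : Matrix (Fin 3) (Fin 3) L)).map W.1.embedding -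
            W.1.embedding e₁ • (1 : Matrix (Fin 3) (Fin 3) ℂ)) x = 0 →
        (∑ i, ∑ j, starRingEnd ℂ (x i) * W.1.embedding (H' i j) * x j) = 0 → x = 0) ↔
      kottwitzSignAt L 3 H' W (cmRationalToArch L 3 H' γ₀) = -1 := by
  classical
  set φ : L →+* ℂ := W.1.embedding with hφ
  obtain ⟨P, d, -, -, hdσ, hd0, hHP, hγP⟩ := exists_pinned_diagonal_frame (cmConjRingHom L) (IsCMField.complexConj_apply_apply L)
    (by norm_num) hherm (det_ne_zero_of_anisotropic_herm L H' hanis) (γ₀ : unitaryGroup (cmConjRingHom L) H') hne hsplit hχ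
  have hγPfin : ((((γ₀ : unitaryGroup (cmConjRingHom L) H').val : GL (Fin 3) L) : Matrix (Fin 3) (Fin 3) L)) * (P : Matrix (Fin 3) (Fin 3) L) =
      (P : Matrix (Fin 3) (Fin 3) L) * finSum 2 1 (e₁ • (1 : Matrix (Fin 2) (Fin 2) L)) (e₂ • (1 : Matrix (Fin 1) (Fin 1) L)) := by
    rw [hγP, finSum_smul_one_eq_diagonal]
  -- LEFT: binary definiteness of `⟨φ d₀, φ d₁⟩` (§1, frame mapped to `ℂ` along `φ`)
  have hσφ : ∀ x : L, starRingEnd ℂ (φ x) = φ (cmConjRingHom L x) := fun x => by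
    rw [cmConjRingHom_apply, IsCMField.complexEmbedding_complexConj]
  have hform : ∀ x : Fin 3 → ℂ, (∑ i, ∑ j, starRingEnd ℂ (x i) * φ (H' i j) * x j) = hermForm (starRingEnd ℂ) (H'.map φ) x x := fun x =>
    sum_sum_mul_eq_hermForm (starRingEnd ℂ) (H'.map φ) x
  have hleft : (∀ x : Fin 3 → ℂ,
        Matrix.mulVec (((((γ₀ : unitaryGroup (cmConjRingHom L) H').val : GL (Fin 3) L) : Matrix (Fin 3) (Fin 3) L)).map φ -
            φ e₁ • (1 : Matrix (Fin 3) (Fin 3) ℂ)) x = 0 →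
        (∑ i, ∑ j, starRingEnd ℂ (x i) * φ (H' i j) * x j) = 0 → x = 0) ↔
      ∀ u : Fin 2 → ℂ, φ (d 0) * (starRingEnd ℂ (u 0) * u 0) + φ (d 1) * (starRingEnd ℂ (u 1) * u 1) = 0 → u = 0 := by
    rw [← aniso_eigenplane_map_iff_binary_of_frame (cmConjRingHom L) (starRingEnd ℂ) φ hσφ P (sub_ne_zero.2 hne.symm).isUnit hγP hHP]
    simp only [hform]
  rw [hleft]
  -- RIGHT: ★ `KottwitzSignPlaceReadings` reads the coordinate sign on the same binary form
  have hreal : ∀ i, (φ (d i)).im = 0 := fun i => by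
    rw [← Complex.conj_eq_iff_im, hσφ, hdσ]
  have hφ0 : ∀ i, φ (d i) ≠ 0 := fun i => (map_ne_zero φ).2 (hd0 i)
  rw [kottwitzSignAt_cmRationalToArch_eq_neg_one_iff W γ₀ (sub_ne_zero.2 hne).isUnit hdσ hd0 hHP hγPfin, map_mul,
    ← binary_anisotropic_iff_mul_pos (hreal 0) (hreal 1) (hφ0 0) (hφ0 1)]

end CM

end Summit.HodgeConjecture.HodgeConjecture.Cruxes.H413.K2E4SingularPairEigenplane

end
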